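import Summits.BirchSwinnertonDyer.Rank1Residual.O5.HeegnerLogTransportThreeChain
import Summits.BirchSwinnertonDyer.Rank1Residual.Additive.PadicLogFormalGroup
import Literature.NumberTheory.EllipticCurves.KrizLi2019.HeegnerLogCongruence
import Literature.NumberTheory.EllipticCurves.LFunctionCoefficientBound
import Literature.NumberTheory.EllipticCurves.RootNumberAtkinLehnerSemistableProofs
import Literature.NumberTheory.EllipticCurves.ModularCurveManinConstantProofs
import Literature.NumberTheory.EllipticCurves.CuspFormLFunctionLevelConductorProofs
import Literature.NumberTheory.DiophantineGeometry.LocalReduction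
import Literature.NumberTheory.QuadraticFields.KroneckerSplitting
import HarnessLib
import HarnessLib.Audit.Tags

/-!
# O5 (t′) — KL3 part 14: the node KL3-A is a THEOREM modulo two cited named facts

Research route (cell `b2b-bsdres`, class O5 = tame potentially-supersingular additive `p = 3` (t′));
**honest framing**: nothing here books a class or moves a mark / label / count / tier. O5 stays OPEN.

The KL3 chain (`HeegnerLogTransportThree*`) was kernel-checked modulo ONE typed node on the `W`-side,
KL3-A = `KrizLiUnitBitTransportThree` (Kriz–Li, *FMS* 7 (2019) e15, Thm. 1.16 at `p = 3`, `m = 1`,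
read as "unit bit transport"). The cell's literature registry (lit GEN 90, verdict A-LIT-G21-1) has
vendored Theorem 1.16 AS PRINTED (value form, any `p`, `m = 1`, conductor levels) as the named fact
`KrizLi2019.thm116_padicLogHeegner_congruence` together with the PROVED valuation corollary
`KrizLi2019.eulerFactorOrd_add_padicLogOrd_sub_eq_zero_iff_of_thm116`, whose side conditions are

* `eulerFactor p W G ≠ 0` — discharged here from `|Ẽ^{ns}(𝔽_ℓ)| ≥ 1` (§1, Hasse / `a_ℓ = ±1` / `a_ℓ = 0`);
* `Castella2018.padicLogOmega W p ι P ≠ 0` for `P` of infinite order — §2: the receptacle's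
  `log_{ω_E} P` IS the Additive cell's `ℤ_p`-linear logarithm `padicLog (W ⊗ ℚ_p) P_ι`, whose kernel is
  the torsion (`padicLog_eq_zero_iff`);
* `D.maninConstant ≠ 0` — the tree theorem `maninConstant_ne_zero_holds`;
* `p` split in `K` — §3: an imaginary quadratic `K` that EMBEDS in `ℚ_p` (`ι_p : K →+* ℚ_p`, a binder of
  KL3-A) with `p ∤ d_K`, `p` odd, has `p` split (`d_K = (2ω − t)²` is a non-zero square in `ℚ_p`, hence
  mod `p`; decomposition law `ncard_primesOver_eq_two_iff_legendreSym`);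
* level = conductor — KL3-A quantifies over `ModularParametrizationData W N` at any level `N`, the print
  (and the fact) lives at `N = N_W`: bridged by Carayol's theorem, the tree's named fact
  `IsNewformOf.level_eq_conductorNorm` (`[cite: Carayol1986]`), which the tree PROVES from the modularity
  fact `exists_isNewformOf` (`IsNewformOf.level_eq_conductorNorm_of_exists_isNewformOf'`, multiplicity
  one) — and `exists_isNewformOf` is already a displayed binder (`hmod`) of every END of the chain.

**Main theorems**: `krizLiUnitBitTransportThree_of_thm116 :
KrizLi2019.thm116_padicLogHeegner_congruence → (∀ N, IsNewformOf.level_eq_conductorNorm) →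
KrizLiUnitBitTransportThree` and `krizLiUnitBitTransportThree_of_thm116_of_exists_isNewformOf :
KrizLi2019.thm116_padicLogHeegner_congruence → exists_isNewformOf → KrizLiUnitBitTransportThree`.
Consequently every END of the chain (parts 7/9/11b: `o5_index_unit_of_*`, all of which carry `hmod`)
holds with its binder `hA` replaced by the ONE cited fact `KrizLi2019.thm116_padicLogHeegner_congruence`
— i.e. the O5 (t′) conditional theorem "BSD₃-unit-index for the listed pairs ⇐ {Kriz–Li 1.16, PT, EP,
Kolyvagin, GZ+K, modularity, Yan–Zhu A10, Wuthrich L20}" is now assembled from PUBLISHED theorems only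
(all vendored as named facts) plus kernel-checked glue; no typed node of the cell's own remains on the
`W`-side path.
What it does NOT do: prove Theorem 1.16 (a fact, debt +1 in the registry's count, consumer named), nor
discharge the per-pair CENSUS inputs (companion `G`, `3 ∤ c_G`-side units, Heegner field) — those stay
EVIDENCE (jobs of record), never Literature facts.

Sources: [cite: KrizLi2019, Thm. 1.16, Rem. 1.17 (FMS 7 (2019) e15, pp. 2, 9–11)];
[cite: Carayol1986]; [cite: SilvermanAEC2009, IV.6.4, V.1.1, VII.2.2, VII.6.3];
Marcus, *Number Fields*, Ch. 3 Thm. 25 (decomposition law) [folklore].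

## TYPER PLACEMENT NOTE (cc-typer-5 GEN 18 = O5 §3.5 / O6 §3.4 typer of record; by-name ask A-O5-G21-1 addendum (e) of o5-r2 GEN 21 ADDENDUM 4, HOME/INBOX.md l.14114;
cc-lead GEN 77 l.14166 'parts 14 / 15 ADMISSIBLE after p350088 is built + 9 placed')

Source: `HOME/b2b-bsdres-o5-r2/gen21/lean/HeegnerLogTransportThreeKrizLiGlue.lean` sha16 `00fb7784afd48b93` (267 l.; `gen21/SHA16.txt`; o5-r2's checks: `scratch_p14_inline.lean` e84ef370df54a660 rc 0 / 0 warnings,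
`scratch_p14_axioms.lean` dd833d4a1d50a634 axioms ×5 std, `scratch_p8_10ab_9_14_15_tree.lean` 1eac65a325584ba8 rc 0, axioms of `o5_index_unit_of_ordinary_companion_cited` std),
re-hashed by the typer right before writing; THIS file = KL3 part 14 = the source VERBATIM + this paragraph (imports, module text, every declaration block byte-identical;
script `class-closure/typer-5/gen18/g21e_place.py`, which also asserts that the tree's `Literature/NumberTheory/EllipticCurves/KrizLi2019/HeegnerLogCongruence.lean` is
p350088's 23986c2bbd5a491a (lit GEN 90, ACCEPTED 0cc14a4fe2bd; CITED-FACTS §A A314 `KrizLi2019.thm116_padicLogHeegner_congruence`, REFEREE 2 R2-127.3 CONFORMANT) — so no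
re-sync of §4 is needed); the typer's own farm check + DEDUP (`lean search --decl` on the new names: no match) precede the proposal.
CONTENT LABELS (source, unchanged): THEOREMS ONLY — 0 `def`, 0 `@[conjecture]`, 0 NEW Literature facts (net named-fact debt 0), no `sorry`; the published inputs stay displayed
hypotheses by NAME — here Kriz–Li Thm. 1.16 enters as the REGISTERED Literature fact `(h : KrizLi2019.thm116_padicLogHeegner_congruence)` and modularity as `exists_isNewformOf`;
KL3-A `KrizLiUnitBitTransportThree` (part 1, p340741) is NOT re-worded in place (append-only): part 14 PROVES it from {A314, modularity}, part 15 re-displays part 9's END with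
`hA` replaced by `hKL`.  Its docstring restamp in part 1 ('THEOREM modulo the cited fact A314 + modularity', citing part 14's pid) is a separate DOC-ONLY touch, docketed.
KL3 parts in the tree: 1–3 p340741 / p341262 / p341640, Global p342632, OrdCompanion p343587 + p344465, OrdSelmer p345030 + p345686, OrdTwist p346273, Residual Engine p347366 +
Residual p348865 + End p350277, BaseSelmer p349318, ExactCount p349954, GoodSelmer p350559, TameTamagawa p350983, RatLogUnit p351404 (+ ResidualEndFacts / BaseSelmerCount,
this seat), Literature index lemma p344022, Literature A314 p350088.  HONEST FRAMING (cell `b2b-bsdres`): research route, lane CLASS-CLOSURE §3.5 O5; a CONDITIONAL theorem —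
nothing asserted beyond the displayed binders, nothing booked, no mark of `RESIDUAL-MAP.md` moves; census = EVIDENCE, never a Literature fact; O5 OPEN.
-/

noncomputable section

open scoped Classical

open WeierstrassCurve NumberField IsDedekindDomain
open Literature.NumberTheory.EllipticCurves Literature.NumberTheory.EllipticCurves.ModularForms
open Summit.BirchSwinnertonDyer.Rank1Residual.X11b (padicLogOrd)

namespace Summit.BirchSwinnertonDyer.Rank1Residual.O5.HeegnerLogTransport

/-! ## §1 `|Ẽ^{ns}(𝔽_ℓ)| ≥ 1`: the Euler-type factor of Thm. 1.16 is non-zero -/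

/-- At the place `v` of `𝓞 ℚ` over `ℓ`: `0 < nsCount W ℓ` — good `ℓ`: `a_ℓ ≤ 2√ℓ < ℓ + 1` (Hasse, tree
`abs_LFunction_prime_pow_le`); multiplicative: `a_ℓ = ±1`, count `ℓ ∓ 1 ≥ 1`; additive: `a_ℓ = 0`, count `ℓ`.
[cite: SilvermanAEC2009, V.1.1 and §C.16] [cite: KrizLi2019, Rem. 1.17] -/
theorem nsCount_primesEquiv_pos (W : WeierstrassCurve ℚ) [W.IsElliptic] (v : HeightOneSpectrum (𝓞 ℚ)) :
    0 < nsCount W (Rat.HeightOneSpectrum.primesEquiv v) := by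
  set ℓ : ℕ := (Rat.HeightOneSpectrum.primesEquiv v : ℕ) with hℓdef
  have hℓ : ℓ.Prime := (Rat.HeightOneSpectrum.primesEquiv v).2
  have hℓ2 : (2 : ℤ) ≤ ℓ := by exact_mod_cast hℓ.two_le
  unfold nsCount
  rw [dif_pos hℓ]
  rcases hasGoodReductionAt_or_hasMultiplicativeReductionAt_or_hasAdditiveReductionAt v W with hg | hm | ha
  · -- good reduction: Hasse
    have hgp : (haveI := Fact.mk (Rat.HeightOneSpectrum.primesEquiv v).2;
        W.HasGoodReductionAtPrime (Rat.HeightOneSpectrum.primesEquiv v)) :=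
      (hasGoodReductionAtPrime_iff_hasGoodReductionAt_ringOfIntegers v W).mpr hg
    rw [if_pos hgp]
    have hH : |(W.LFunction ℓ : ℝ)| ≤ 2 * Real.sqrt ℓ := by
      have h := abs_LFunction_prime_pow_le W hℓ 1
      norm_num at h
      simpa using h
    have hsq : Real.sqrt ℓ ^ 2 = ℓ := Real.sq_sqrt (Nat.cast_nonneg ℓ)
    have hs1 : Real.sqrt ℓ - 1 ≠ 0 := by
      intro h
      have h1 : Real.sqrt (ℓ : ℝ) = 1 := by linarith
      have : (ℓ : ℝ) = 1 := by rw [← hsq, h1]; norm_num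
      exact hℓ.one_lt.ne' (by exact_mod_cast this)
    have key : (2 : ℝ) * Real.sqrt ℓ < ℓ + 1 := by
      nlinarith [sq_pos_of_ne_zero hs1, hsq]
    have hlt : ((W.LFunction ℓ : ℤ) : ℝ) < ℓ + 1 := lt_of_le_of_lt ((le_abs_self _).trans hH) key
    have hlt' : (W.LFunction ℓ : ℤ) < ℓ + 1 := by exact_mod_cast hlt
    omega
  · -- multiplicative reduction
    have hng : ¬ (haveI := Fact.mk (Rat.HeightOneSpectrum.primesEquiv v).2;
        W.HasGoodReductionAtPrime (Rat.HeightOneSpectrum.primesEquiv v)) := fun h =>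
      ((hasGoodReductionAtPrime_iff_hasGoodReductionAt_ringOfIntegers v W).mp h).not_hasMultiplicativeReductionAt
        hm
    rw [if_neg hng]
    by_cases hs : W.HasSplitMultiplicativeReductionAt v
    · have h1 : W.LFunction ℓ = 1 := W.LFunction_apply_primesEquiv_of_hasSplitMultiplicativeReductionAt hs
      rw [h1]; omega
    · have h1 : W.LFunction ℓ = -1 :=
        W.LFunction_apply_primesEquiv_of_hasMultiplicativeReductionAt_of_not_split hm hs
      rw [h1]; omega
  · -- additive reduction
    have hng : ¬ (haveI := Fact.mk (Rat.HeightOneSpectrum.primesEquiv v).2;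
        W.HasGoodReductionAtPrime (Rat.HeightOneSpectrum.primesEquiv v)) := fun h =>
      ((hasGoodReductionAtPrime_iff_hasGoodReductionAt_ringOfIntegers v W).mp h).not_hasAdditiveReductionAt ha
    rw [if_neg hng]
    have h0 : W.LFunction ℓ = 0 := W.LFunction_apply_primesEquiv_of_hasAdditiveReductionAt ha
    rw [h0]; omega

/-- **`0 < nsCount W ℓ` at every prime `ℓ`** (`|Ẽ^{ns}(𝔽_ℓ)| ≥ 1`). [cite: KrizLi2019, Rem. 1.17]
[cite: SilvermanAEC2009, V.1.1 and §C.16] -/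
theorem nsCount_pos (W : WeierstrassCurve ℚ) [W.IsElliptic] {ℓ : ℕ} (hℓ : ℓ.Prime) : 0 < nsCount W ℓ := by
  have h := nsCount_primesEquiv_pos W ((Rat.HeightOneSpectrum.primesEquiv (R := 𝓞 ℚ)).symm ⟨ℓ, hℓ⟩)
  rwa [Equiv.apply_symm_apply] at h

/-- **Kriz–Li's Euler-type factor `∏_{ℓ ∣ pNN′/M} |Ẽ^{ns}(𝔽_ℓ)|/ℓ` is non-zero** (every count is `≥ 1`;
`nsPointCount = nsCount` by `rfl`). Discharges the binder `hEW` / `hEG` of the registry's corollary.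
[cite: KrizLi2019, Thm. 1.16 and Rem. 1.17] -/
theorem eulerFactor_ne_zero (p : ℕ) (W G : WeierstrassCurve ℚ) [W.IsElliptic] :
    KrizLi2019.eulerFactor p W G ≠ 0 := by
  unfold KrizLi2019.eulerFactor
  refine Finset.prod_ne_zero_iff.mpr fun ℓ hℓ => ?_
  have hℓp : ℓ.Prime := (KrizLi2019.prime_of_mem_depletionPrimes hℓ).1
  have h0 : 0 < KrizLi2019.nsPointCount W ℓ := nsCount_pos W hℓp
  exact div_ne_zero (by exact_mod_cast h0.ne') (Nat.cast_ne_zero.mpr hℓp.ne_zero)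

/-! ## §2 `log_{ω_E} P` (the receptacle's reading) is the `ℤ_p`-linear logarithm of `P_ι` -/

section LogOmega

variable (W : WeierstrassCurve ℚ) [W.IsElliptic] [W.IsGloballyMinimal] (p : ℕ) [Fact p.Prime]
  {K : Type} [Field K] [NumberField K] (ι : K →+* ℚ_[p]) (P : (W.baseChange K).toAffine.Point)

/-- **`log_{ω_E} P = padicLog (W ⊗ ℚ_p) P_ι`**: Castella's `log_W(z(m₀ • P_ι))/m₀`
(`m₀ = [E(ℚ_p) : E₁(ℚ_p)]`) is the Additive cell's `ℤ_p`-linear logarithm `L(N • P_ι)/N`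
(`N = [E(ℚ_p) : E⁽²⁾(ℚ_p)] = p·m₀`, `log_W z(p • Q) = p·log_W z(Q)` on `E₁(ℚ_p)`) — the same eight-line
computation as the x11b cell's `R1.logOmega_eq_padicLog`, restated for the Literature reading so that the
O5 chain does not import x11b route files. [cite: SilvermanAEC2009, IV.6.4 and VII.6.3]
[cite: Castella2018, §2.2 (arXiv:1704.06608 p. 5)] -/
theorem padicLogOmega_eq_padicLog :
    Castella2018.padicLogOmega W p ι P =
      Additive.LocalLog.padicLog (W.baseChange ℚ_[p]) (X11b.padicPointOf W p ι P) := by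
  set X := W.baseChange ℚ_[p] with hX
  have hm : X.IsInReductionKernel ((X.formalFiltration 1).index • X11b.padicPointOf W p ι P) :=
    ((X.formalFiltration 1).nsmul_index_mem _).1
  have hp0 : (p : ℚ_[p]) ≠ 0 := Nat.cast_ne_zero.mpr (Fact.out : p.Prime).ne_zero
  rw [Additive.LocalLog.padicLog_eq_padicLogPoint_nsmul_div, X11b.LocalIndex.index_formalFiltration_two,
    mul_nsmul', Additive.LocalLog.padicLogPoint_nsmul X hm p, Nat.cast_mul, mul_div_mul_left _ _ hp0]
  rfl

variable {P} in
/-- **`log_{ω_E} P ≠ 0` for `P ∈ E(K)` of infinite order** (kernel of `padicLog` = torsion; `P ↦ P_ι` is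
injective). Discharges the binder `hLW` / `hLG` of the registry's corollary.
[cite: SilvermanAEC2009, IV.6.4 and VII.6.3] -/
theorem padicLogOmega_ne_zero (hP : ¬ IsOfFinAddOrder P) : Castella2018.padicLogOmega W p ι P ≠ 0 := by
  rw [padicLogOmega_eq_padicLog, ne_eq, Additive.LocalLog.padicLog_eq_zero_iff]
  exact not_isOfFinAddOrder_padicPointOf W p ι P hP

end LogOmega

/-! ## §3 A quadratic field that embeds in `ℚ_p` (`p` odd, `p ∤ d_K`) has `p` split -/

/-- **Embedding ⇒ split.** For `[K : ℚ] = 2`, an odd prime `p ∤ d_K` and a ring map `ι : K →+* ℚ_p`: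
exactly two primes of `𝓞 K` lie over `p`. Proof: with an integral basis `(1, ω)`, `ω² = m + tω`,
`d_K = t² + 4m = (2ω − t)²` (tree `discr_eq_sq_add_four_mul`), so `x = ι(2ω − t) ∈ ℚ_p` has `x² = d_K`,
`|x|_p = 1`; reducing `x ∈ ℤ_p` mod `p` makes `d_K` a non-zero square in `𝔽_p`, i.e. `(d_K/p) = 1`, and the
decomposition law (tree `ncard_primesOver_eq_two_iff_legendreSym`, Marcus Ch. 3 Thm. 25) gives the
split. (KL3-A carries the binder `ι₃ : K →+* ℚ_[3]`; the print / the registry's fact ask "`p` split in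
`K`" — this lemma is the bridge.) [folklore] -/
theorem ncard_primesOver_eq_two_of_ringHom_padic {K : Type*} [Field K] [NumberField K]
    (h2 : Module.finrank ℚ K = 2) {p : ℕ} [Fact p.Prime] (hp2 : p ≠ 2)
    (hd : ¬ (p : ℤ) ∣ NumberField.discr K) (ι : K →+* ℚ_[p]) :
    ((Ideal.span {(p : ℤ)}).primesOver (𝓞 K)).ncard = 2 := by
  obtain ⟨b, hb⟩ := Literature.NumberTheory.QuadraticFields.Quadratic.exists_basis_zero_eq_one h2
  -- `ω² = m + t ω` in `𝓞 K`, read in `K`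
  have hω : b 1 * b 1 =
      ((b.repr (b 1 * b 1) 0 : ℤ) : 𝓞 K) + ((b.repr (b 1 * b 1) 1 : ℤ) : 𝓞 K) * b 1 := by
    have hs := b.sum_repr (b 1 * b 1)
    rw [Fin.sum_univ_two, hb, zsmul_eq_mul, zsmul_eq_mul, mul_one] at hs
    exact hs.symm
  have hωK : ((b 1 : 𝓞 K) : K) * ((b 1 : 𝓞 K) : K) =
      ((b.repr (b 1 * b 1) 0 : ℤ) : K) + ((b.repr (b 1 * b 1) 1 : ℤ) : K) * ((b 1 : 𝓞 K) : K) := by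
    have h := congrArg ((↑) : 𝓞 K → K) hω
    push_cast at h
    exact h
  -- `α = 2ω − t` has `α² = d_K`
  have hα : (2 * ((b 1 : 𝓞 K) : K) - ((b.repr (b 1 * b 1) 1 : ℤ) : K)) ^ 2 =
      (NumberField.discr K : K) := by
    rw [Literature.NumberTheory.QuadraticFields.Quadratic.discr_eq_sq_add_four_mul b hb]
    push_cast
    linear_combination (4 : K) * hωK
  -- `x = ι α ∈ ℚ_p` with `x² = d_K` is a `p`-adic unit
  set x : ℚ_[p] := ι (2 * ((b 1 : 𝓞 K) : K) - ((b.repr (b 1 * b 1) 1 : ℤ) : K)) with hx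
  have hx2 : x ^ 2 = (NumberField.discr K : ℚ_[p]) := by
    rw [hx, ← map_pow, hα, map_intCast]
  have hd1 : ‖(NumberField.discr K : ℚ_[p])‖ = 1 :=
    le_antisymm (Padic.norm_int_le_one _)
      (not_lt.mp fun hlt => hd (Padic.norm_intCast_lt_one_iff.mp hlt))
  have hx1 : ‖x‖ = 1 := by
    have h : ‖x‖ ^ 2 = 1 := by rw [← norm_pow, hx2, hd1]
    exact (pow_eq_one_iff_of_nonneg (norm_nonneg x) two_ne_zero).mp h
  -- reduce mod `p`: `d_K` is a non-zero square in `𝔽_p`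
  set x' : ℤ_[p] := ⟨x, hx1.le⟩ with hx'
  have hx'2 : x' ^ 2 = (NumberField.discr K : ℤ_[p]) := by
    apply PadicInt.ext
    rw [PadicInt.coe_pow, PadicInt.coe_intCast]
    exact hx2
  have hsq : IsSquare ((NumberField.discr K : ℤ) : ZMod p) :=
    ⟨PadicInt.toZMod x', by rw [← map_mul, ← sq, hx'2, map_intCast]⟩
  have h0 : ((NumberField.discr K : ℤ) : ZMod p) ≠ 0 :=
    fun h => hd ((ZMod.intCast_zmod_eq_zero_iff_dvd _ _).mp h)
  exact (Literature.NumberTheory.QuadraticFields.Quadratic.ncard_primesOver_eq_two_iff_legendreSym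
    h2 hp2).mpr ((legendreSym.eq_one_iff p h0).mpr hsq)

/-! ## §4 The glue: KL3-A from Kriz–Li Thm. 1.16 (registry fact) and Carayol (level = conductor) -/

/-- **KL3-A is a theorem modulo `{Kriz–Li Thm. 1.16, Carayol}`.** From the registry's named fact
`KrizLi2019.thm116_padicLogHeegner_congruence` (Thm. 1.16 as printed, `m = 1`) and the tree's named fact
`IsNewformOf.level_eq_conductorNorm` (the level of `D : ModularParametrizationData W N` is `N_W`), the
O5 node `KrizLiUnitBitTransportThree` follows: specialise the fact at `p = 3`, move to conductor level
by Carayol, supply the split of `3` in `K` from the binder `ι₃ : K →+* ℚ_[3]` and `3 ∤ d_K` (§3), and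
read the valuation corollary (`eulerFactorOrd 3 = klExponent`, `nsPointCount = nsCount`, Literature
`padicLogOrd` = `X11b.padicLogOrd`, all by `rfl`) with its side conditions discharged by §1, §2 and
`maninConstant_ne_zero_holds`. The binders `d_K < −4`, `P, P′` Heegner images are passed through /
unused exactly as the print allows. [cite: KrizLi2019, Thm. 1.16, Rem. 1.17 (FMS 7 (2019) e15)]
[cite: Carayol1986] -/
theorem krizLiUnitBitTransportThree_of_thm116 (h : KrizLi2019.thm116_padicLogHeegner_congruence)
    (hC : ∀ (N : ℕ) [NeZero N], IsNewformOf.level_eq_conductorNorm (N := N)) :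
    KrizLiUnitBitTransportThree := by
  intro W G _ _ _ _ hcong N N' _ _ D D' K _ _ hK hH hH' _hd h3 H H' ι ι₃ P P' hPH hPH' hP hP'
  obtain rfl : N = W.conductorNorm ℤ := hC N D.isNewformOf
  obtain rfl : N' = G.conductorNorm ℤ := hC N' D'.isNewformOf
  haveI : Fact (Nat.Prime 3) := ⟨Nat.prime_three⟩
  have hsplit : ((Ideal.span {((3 : ℕ) : ℤ)}).primesOver (𝓞 K)).ncard = 2 :=
    ncard_primesOver_eq_two_of_ringHom_padic hK.1 (by decide) (by exact_mod_cast h3) ι₃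
  exact KrizLi2019.eulerFactorOrd_add_padicLogOrd_sub_eq_zero_iff_of_thm116 3 W G h hcong D D' K hK hH
    hH' hsplit H H' ι ι₃ P P' hPH hPH' (eulerFactor_ne_zero 3 W G) (eulerFactor_ne_zero 3 G W)
    (padicLogOmega_ne_zero W 3 ι₃ hP) (padicLogOmega_ne_zero G 3 ι₃ hP')
    D.maninConstant_ne_zero_holds D'.maninConstant_ne_zero_holds

/-- **KL3-A is a theorem modulo `{Kriz–Li Thm. 1.16, modularity}`**: the level-to-conductor step is the
tree's PROVED `IsNewformOf.level_eq_conductorNorm_of_exists_isNewformOf'` (Carayol's statement from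
`exists_isNewformOf` + multiplicity one), so the only inputs are the registry fact and the modularity fact
`exists_isNewformOf` that every END of the chain already displays as `hmod`.
[cite: KrizLi2019, Thm. 1.16, Rem. 1.17 (FMS 7 (2019) e15)] [cite: BreuilConradDiamondTaylor2001]
[cite: DiamondShurman2005, Thm. 8.8.3] -/
theorem krizLiUnitBitTransportThree_of_thm116_of_exists_isNewformOf
    (h : KrizLi2019.thm116_padicLogHeegner_congruence) (hmod : exists_isNewformOf) :
    KrizLiUnitBitTransportThree :=
  krizLiUnitBitTransportThree_of_thm116 h fun _ _ =>
    IsNewformOf.level_eq_conductorNorm_of_exists_isNewformOf' hmod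

end Summit.BirchSwinnertonDyer.Rank1Residual.O5.HeegnerLogTransport

end
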